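import Literature.AlgebraicGeometry.Milne1999.SpecialLefschetzGroupInvariantsGLMultiplicity
import Literature.AlgebraicGeometry.Milne1999.SpecialLefschetzGroupInvariantsSpBlocksMultiplicity
import Literature.RepresentationTheory.ClassicalInvariants.TensorFFTLetterColoured
import Literature.AlgebraicGeometry.VanGeemen1994.WeilTypeHodgeGroupSU
import HarnessLib

/-!
# Milne 1999, Thm. 3.2 / Prop. 3.6 on the tree's carriers: a letter-coloured criterion for Lefschetz classes

Family `hodge`, layer `Literature/AlgebraicGeometry/Milne1999`, namespace `Literature.AlgebraicGeometry.Milne1999`.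
No definition, no named fact, no `sorry` (D-0026, net debt 0).  Cell `pub-hodgecm2` (COR-CM), seat `lit-milne`,
binder table `HOME/lit/milne.md` rows M2/M4 (record `Milne1999_specialLefschetzGroup_invariants_le` of
`Milne1999/LefschetzGroup`).  Sequel of `SpecialLefschetzGroupInvariantsFormBlocksMultiplicity` / `…GLMultiplicity`,
whose common limitation was a basis of `H¹` indexed `J × Fin N` with ONE alphabet size `N` for all blocks.  Here
the blocks may have DIFFERENT ranks and multiplicities: the criterion is stated for a basis indexed by the letters
`Fin N` of `H¹` themselves, coloured by `lcol : Fin N → ι`, and an ABSTRACT one-colour first fundamental theorem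
`hone` per colour (supplied, colour by colour, by `ClassicalInvariants.TensorFFTLetterColoured`: `Sp`/`O` blocks
`mem_span_pairContraction_of_formBlock_invariant`, `GL` pairs `mem_span_pairContraction_of_glBlock_invariant`).

## Source, verbatim

J. S. Milne, *Lefschetz classes on abelian varieties*, Duke Math. J. 96 (1999) 639–675
[`paper:doi-10-1215-s0012-7094-99-09620-5`, held; PDF page = printed page − 638]: Thm. 3.2 (p. 653) "the
`k`-algebra `(⊗^* V)^{C(E)}` is generated by `(⊗² V)^{C(E)}`"; p. 656 L14–L40: "`(⋀^*(⊕ rH_σ))^{∏ S_σ} =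
⊗_σ (⋀^* rH_σ)^{S_σ}`.  Hence it suffices to show that each of the `k`-algebras `(⋀^* rH_σ)^{S_σ}` is generated
by tensors of degree 2", Prop. 3.6 (a) `Sp`, (b) `O`, (c) `GL` (p. 655); Prop. 3.3 (p. 653: the degree-2
invariants are the divisor classes); Cor. 4.5 (p. 659): "`H^{2*}(A^r)(*)^{L(A)} = D_hom(A^r)_k`."

## What is proved

`mem_divisorClassesSpan_of_forall_exteriorPullback_eq_of_letterColouring`: DATA a complex abelian variety `B`, a
basis `b : Fin N → H¹(B(ℂ); ℂ)`, a colouring `lcol : Fin N → ι` of the letters, for every colour a set `grp i` of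
`N × N` matrices which are the identity off the letters of colour `i`, a set `ker i` of admissible pair kernels,
the one-colour FFT `hone` (every `grp i`-invariant tensor supported on the letters of colour `i` is a combination
of pair contractions with kernels in `ker i`), a subgroup `G ≤ GL(H¹)` realising every `g ∈ grp i`
(`u (b j) = Σ_{j'} g_{j' j} b_{j'}`), and the hypothesis that every kernel class `Σ M_{j j'} b_j ⌣ b_{j'}`,
`M ∈ ker i`, lies in `B¹(B) ⊗ ℂ`.  CONCLUSION: every class of `H^{2p}` fixed by `⋀^{2p} u` for all `u ∈ G` lies
in `Dᵖ(B) ⊗ ℂ`.  Proof = p. 656: write `x = Σ_w a(w) b_w` with `a` antisymmetric; `a` is invariant under the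
Kronecker powers of every `g ∈ grp i` (`wordRepAt_wordSlice_eq_of_exteriorPullback_eq'`); split `a` by the
colour patterns `κ : Fin 2p → ι` of the words (each piece is again invariant, since the `g`'s are block diagonal);
apply the letter-coloured FFT `mem_span_pairContraction_of_invariant_aux` to each piece; evaluate each pair
contraction on the basis (`sum_colouredContraction_smul_eq`): `±` a cup product of `p` kernel classes, which is in
`Dᵖ ⊗ ℂ` (`sum_smul_cupPowOne_spPairWord_mem_family`).
-/

noncomputable section

open scoped BigOperators Matrix
open CategoryTheory
open Literature.AlgebraicTopology.SingularHomology
open Literature.AlgebraicGeometry.HodgeTheory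
open Literature.AlgebraicGeometry.Motives
open Literature.AlgebraicGeometry.VanGeemen1994 (hodgeClassSpan)
open Literature.Barriers.HodgeConjecture (divisorClassesSpan)
open Literature.RepresentationTheory.GeneralLinear
open Literature.RepresentationTheory.ClassicalInvariants
open Literature.NumberTheory.DiophantineGeometry

namespace Literature.AlgebraicGeometry.Milne1999

/-- Matrices which are the identity off the letters of colour `i` are colour-preserving: an entry between
letters of different colours vanishes. [cite: Milne1999LefschetzClasses, §2 p. 656] -/
private theorem entry_eq_zero_of_lcol_ne {ι : Type} {N : ℕ} (lcol : Fin N → ι) (i : ι) (g : Matrix (Fin N) (Fin N) ℂ)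
    (hg : ∀ j j', (lcol j ≠ i ∨ lcol j' ≠ i) → g j' j = (1 : Matrix (Fin N) (Fin N) ℂ) j' j)
    {j j' : Fin N} (h : lcol j' ≠ lcol j) : g j' j = 0 := by
  have hne : j' ≠ j := fun hh => h (by rw [hh])
  by_cases hj : lcol j = i
  · rw [hg j j' (Or.inr (by rw [← hj]; exact h)), Matrix.one_apply, if_neg hne]
  · rw [hg j j' (Or.inl hj), Matrix.one_apply, if_neg hne]

variable {B : AbelianVariety ℂ} {ι : Type} [Fintype ι] [DecidableEq ι] {N : ℕ}

/-- **Milne 1999, Thm. 3.2 with Prop. 3.6, letter-coloured form, on the tree's carriers.**  See the module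
docstring. [cite: Milne1999LefschetzClasses, Thm. 3.2 (p. 653), Prop. 3.6 (p. 655), p. 656 and Cor. 4.5 (p. 659)]
[cite: GoodmanWallachGTM255, §4.1.1, Thm. 5.3.1, Thm. 5.3.3 and Thm. 5.3.5] -/
theorem mem_divisorClassesSpan_of_forall_exteriorPullback_eq_of_letterColouring
    (b : Module.Basis (Fin N) ℂ (complexBetti B.X 1)) (lcol : Fin N → ι)
    (grp ker : ι → Set (Matrix (Fin N) (Fin N) ℂ))
    (hone : ∀ (i : ι) (P : Type) [Fintype P] [DecidableEq P] (c : (P → Fin N) → ℂ),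
      (∀ w, (∃ q, lcol (w q) ≠ i) → c w = 0) →
      (∀ g ∈ grp i, ∀ w' : P → Fin N, (∑ w, (∏ q, g (w' q) (w q)) * c w) = c w') →
      c ∈ Submodule.span ℂ {f : (P → Fin N) → ℂ |
        ∃ (k : ℕ) (e : P ≃ Fin 2 × Fin k) (M : Fin k → Matrix (Fin N) (Fin N) ℂ),
          (∀ m, M m ∈ ker i) ∧ f = pairContraction M e})
    (hgrp : ∀ i, ∀ g ∈ grp i, ∀ j j', (lcol j ≠ i ∨ lcol j' ≠ i) → g j' j = (1 : Matrix (Fin N) (Fin N) ℂ) j' j)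
    (G : Subgroup (complexBetti B.X 1 ≃ₗ[ℂ] complexBetti B.X 1))
    (hG : ∀ i, ∀ g ∈ grp i, ∃ u ∈ G, ∀ j, u (b j) = ∑ j', g j' j • b j')
    (hker : ∀ i, ∀ M ∈ ker i,
      (∑ j, ∑ j', M j j' • cupProduct (rfl : 1 + 1 = 2) (b j) (b j')) ∈ hodgeClassSpan B.dim B.X 1)
    (p : ℕ) (x : complexBetti B.X (2 * p))
    (hx : ∀ u ∈ G, exteriorPullback (AbelianVariety.hasExteriorCohomologyH1_complexPoints B)
      (u : complexBetti B.X 1 →ₗ[ℂ] complexBetti B.X 1) (2 * p) x = x) :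
    x ∈ divisorClassesSpan B.X B.dim p := by
  classical
  set F := cupPowOneAlt ℂ (ComplexPoints B.X) (2 * p) with hF
  -- the basis, reindexed by `PUnit × Fin N` (one slot) to use the slice machinery of the tree
  let eU : Fin N ≃ Unit × Fin N := ⟨fun ℓ => ((), ℓ), fun q => q.2, fun _ => rfl, fun _ => rfl⟩
  let b' : Module.Basis (Unit × Fin N) ℂ (complexBetti B.X 1) := b.reindex eU
  have hb' : ∀ (s : Unit) (ℓ : Fin N), b' (s, ℓ) = b ℓ := fun s ℓ => by
    rw [Module.Basis.reindex_apply]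
    rfl
  obtain ⟨a, ha, hax⟩ := exists_isAntisymm_wordEval_eq b' x
  -- every slice is invariant under the Kronecker powers of every `g ∈ grp i`
  have hinv : ∀ (t : Fin (2 * p) → Unit) (i : ι), ∀ g ∈ grp i,
      wordRepAt ℂ (fun _ => g) (wordSlice a t) = wordSlice a t := by
    intro t i g hg
    obtain ⟨u, huG, hu⟩ := hG i g hg
    exact wordRepAt_wordSlice_eq_of_exteriorPullback_eq' b' ha
      (u : complexBetti B.X 1 →ₗ[ℂ] complexBetti B.X 1) (fun _ => g)
      (fun s ℓ => by rw [hb']; simp_rw [hb']; exact hu ℓ) (by rw [hax]; exact hx u huG) t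
  rw [← hax, wordEval_eq_sum_wordSlice]
  refine Submodule.sum_mem _ fun t _ => ?_
  set c := wordSlice a t with hc
  have hcinv : ∀ i, ∀ g ∈ grp i, ∀ w' : Word N (2 * p), ∑ w, (∏ q, g (w' q) (w q)) * c w = c w' := by
    intro i g hg w'
    have h := congrFun (hinv t i g hg) w'
    rwa [wordRepAt_apply] at h
  -- the pieces of `c` along the colour patterns of the words
  let piece : (Fin (2 * p) → ι) → Word N (2 * p) → ℂ := fun κ w => if lcol ∘ w = κ then c w else 0
  have hsum : c = ∑ κ, piece κ := by
    funext w
    rw [Finset.sum_apply]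
    simp only [piece]
    rw [Finset.sum_ite_eq, if_pos (Finset.mem_univ _)]
  have hsupp : ∀ κ (w : Word N (2 * p)), (∃ q, lcol (w q) ≠ κ q) → piece κ w = 0 := by
    rintro κ w ⟨q, hq⟩
    simp only [piece]
    rw [if_neg]
    intro h
    exact hq (congrFun h q)
  -- each piece is invariant, colour by colour
  have hpinv : ∀ (κ : Fin (2 * p) → ι) (i : ι), ∀ g ∈ grp i, ∀ w' : Word N (2 * p),
      (∑ w, (∏ q, (if κ q = i then g else 1) (w' q) (w q)) * piece κ w) = piece κ w' := by
    intro κ i g hg w'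
    have hg' := hgrp i g hg
    by_cases hw' : lcol ∘ w' = κ
    · have hR : piece κ w' = c w' := if_pos hw'
      rw [hR, ← hcinv i g hg w']
      refine Finset.sum_congr rfl fun w _ => ?_
      by_cases hw : lcol ∘ w = κ
      · have hL : piece κ w = c w := if_pos hw
        rw [hL]
        congr 1
        refine Finset.prod_congr rfl fun q _ => ?_
        by_cases hq : κ q = i
        · rw [if_pos hq]
        · rw [if_neg hq]
          have h1 : lcol (w q) ≠ i := by rw [show lcol (w q) = κ q from congrFun hw q]; exact hq
          rw [hg' _ _ (Or.inl h1)]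
      · have hL : piece κ w = 0 := if_neg hw
        rw [hL, mul_zero]
        obtain ⟨q, hq⟩ : ∃ q, lcol (w q) ≠ κ q := by
          by_contra hall
          push Not at hall
          exact hw (funext hall)
        have hne : lcol (w' q) ≠ lcol (w q) := by
          rw [show lcol (w' q) = κ q from congrFun hw' q]; exact fun h => hq h.symm
        rw [Finset.prod_eq_zero (Finset.mem_univ q) (entry_eq_zero_of_lcol_ne lcol i g hg' hne), zero_mul]
    · have hR : piece κ w' = 0 := if_neg hw'
      rw [hR]
      refine Finset.sum_eq_zero fun w _ => ?_
      by_cases hw : lcol ∘ w = κ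
      · obtain ⟨q, hq⟩ : ∃ q, lcol (w' q) ≠ κ q := by
          by_contra hall
          push Not at hall
          exact hw' (funext hall)
        have hne : lcol (w' q) ≠ lcol (w q) := by
          rw [show lcol (w q) = κ q from congrFun hw q]; exact hq
        have h0 : (if κ q = i then g else 1) (w' q) (w q) = 0 := by
          by_cases hqi : κ q = i
          · rw [if_pos hqi]; exact entry_eq_zero_of_lcol_ne lcol i g hg' hne
          · rw [if_neg hqi, Matrix.one_apply, if_neg]
            intro h; exact hne (by rw [h])
        rw [Finset.prod_eq_zero (Finset.mem_univ q) h0, zero_mul]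
      · rw [show piece κ w = 0 from if_neg hw, mul_zero]
  -- the letter-coloured FFT, piece by piece
  have hmem : ∀ κ : Fin (2 * p) → ι, piece κ ∈ Submodule.span ℂ {f : Word N (2 * p) → ℂ |
      ∃ (k : ℕ) (e : Fin (2 * p) ≃ Fin 2 × Fin k) (M : Fin k → Matrix (Fin N) (Fin N) ℂ),
        (∀ m, κ (e.symm (0, m)) = κ (e.symm (1, m)) ∧ M m ∈ ker (κ (e.symm (0, m)))) ∧
          f = pairContraction M e} :=
    fun κ => mem_span_pairContraction_of_invariant_aux lcol grp ker hone (2 * p) (Fin (2 * p)) κ (piece κ)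
      (Fintype.card_fin _) (hsupp κ) (hpinv κ)
  -- evaluation on the basis
  set Λ := Fintype.linearCombination ℂ (fun ε : Word N (2 * p) => F (fun q => b' (t q, ε q))) with hΛ
  have hΛapply : ∀ c' : Word N (2 * p) → ℂ, Λ c' = ∑ ε, c' ε • F (fun q => b' (t q, ε q)) :=
    fun c' => Fintype.linearCombination_apply ℂ _ c'
  rw [← hΛapply, hsum, map_sum]
  refine Submodule.sum_mem _ fun κ _ => ?_
  refine (Submodule.span_le (p := (divisorClassesSpan B.X B.dim p).comap Λ)).2 ?_ (hmem κ)
  rintro _ ⟨k, e, M, he, rfl⟩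
  rw [SetLike.mem_coe, Submodule.mem_comap, hΛapply]
  have hk : k = p := by
    have h := Fintype.card_congr e
    simp only [Fintype.card_fin, Fintype.card_prod] at h
    omega
  subst hk
  have hpc : pairContraction M e = colouredContraction M (fun q => (e q).2) e := by
    funext w
    rw [pairContraction_apply, colouredContraction_apply]
    refine Finset.prod_congr rfl fun m _ => ?_
    rw [Equiv.apply_symm_apply]
  rw [hpc]
  obtain ⟨π, -, hs⟩ := sum_colouredContraction_smul_eq F M (fun q => (e q).2) e (⇑b') t
  rw [hs]
  refine Submodule.smul_mem _ _ ?_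
  simp_rw [hF, cupPowOneAlt_apply]
  refine sum_smul_cupPowOne_spPairWord_mem_family (⇑b') k (fun m => M (e (e.symm (0, m))).2) _ _ fun m => ?_
  simp_rw [Equiv.apply_symm_apply, hb']
  exact hker _ (M m) (he m).2

end Literature.AlgebraicGeometry.Milne1999

end
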